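import Summits.ValiantsHypothesis.ValiantsHypothesis.Theorems.SymPencilPerFourInnerRankHypPairs

/-!
# Route `SymPencil` — inner rank of the `2 | 2` row split of `per_4` on a SUBSPACE of the
# `u`-side, III: the rank lemma and purity (`--supports` stmt-ValiantsHypothesis-5674
# `SdcSuperquadratic`; toward IR9U/IR9H = cell `(9, 7, 8)` of the size-`27` table; rung currency only)

Setting as in `SymPencilPerFourInnerRankHypFamily/HypPairs`: `hJ` on a submodule `U ≤ K⁴ × K⁴`,
a linear section `ρ` of the second projection into `U`, `H_a = {a : (a, 0) ∈ U}`,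
`H_b = {b : (0, b) ∈ U}` (both of dimension `≥ 3` when `dim U = 7`).

* `kappa_eq_zero` — the only symmetric zero-diagonal `4 × 4` matrix `Λ` with `H ≤ ker Λ` for some
  `H ≤ K⁴` of dimension `≥ 3` is `0` (written out for the six entries `κ_S`);
* `false_of_doubly_pure₀` — PURITY: if column `0` is both `τ`-pure and `σ`-pure on `H_a × 0`
  (`t_r((a,0),(e₀,0)) = t_r((a,0),(0,e₀)) = 0`) and every other column is `τ`-pure or `σ`-pure,
  then `per (a; b; e₀; e_y) = 0` on `H_a × H_b` for all `y ≠ 0` (`cross_U`), which the rank lemma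
  forbids;
* `per_single_table` — the values `per (a; e_j; e_k; e_l)` feeding `kappa_eq_zero` in the
  pure-case endgame (`SymPencilPerFourInnerRankHypNine`).

Honest framing: lemmas toward IR9U; cell `(9,7,8)` not killed here; `27 ≤ sdc(per_4) ≤ 29`
unchanged; the crux `SdcSuperquadratic` and `VP ≠ VNP` untouched.  No definitions. [folklore]
-/

noncomputable section

-- single-conjunct layout: Sub = Summit, duplicated namespace component intended
set_option linter.dupNamespace false

namespace Summit.ValiantsHypothesis.ValiantsHypothesis.Theorems.SymPencilPerFourInnerRankHypPurity

open Matrix Finset Module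
open Summit.ValiantsHypothesis.ValiantsHypothesis.Theorems.SymPencilPerFourInnerRankRows
open Summit.ValiantsHypothesis.ValiantsHypothesis.Theorems.SymPencilPerFourInnerRankHypFamily
open Summit.ValiantsHypothesis.ValiantsHypothesis.Theorems.SymPencilPerFourInnerRankHypPairs

variable {K : Type*} [Field K] {ι : Type*} [Fintype ι]

/-! ### Row identities -/

omit [Fintype ι] in
/-- `per (a; b; v; w)` is symmetric in the rows `b, v`. [folklore] -/
theorem per_swap_row₁₂ (a b v w : Fin 4 → K) :
    (Matrix.of ![a, v, b, w]).permanent = (Matrix.of ![a, b, v, w]).permanent := by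
  simp only [permanent_of_rows]; ring

omit [Fintype ι] in
/-- The table of `per (a; e_j; e_k; e_l)` over the six pairs `(j,k) = 01,02,03,12,13,23`, for each
`l`. [folklore] -/
theorem per_single_table (a : Fin 4 → K) (S : Fin 6) :
    (Matrix.of ![a, Pi.single ((![0, 0, 0, 1, 1, 2] : Fin 6 → Fin 4) S) (1 : K),
        Pi.single ((![1, 2, 3, 2, 3, 3] : Fin 6 → Fin 4) S) 1, Pi.single 0 1]).permanent =
      (![0, 0, 0, a 3, a 2, a 1] : Fin 6 → K) S ∧
    (Matrix.of ![a, Pi.single ((![0, 0, 0, 1, 1, 2] : Fin 6 → Fin 4) S) (1 : K),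
        Pi.single ((![1, 2, 3, 2, 3, 3] : Fin 6 → Fin 4) S) 1, Pi.single 1 1]).permanent =
      (![0, a 3, a 2, 0, 0, a 0] : Fin 6 → K) S ∧
    (Matrix.of ![a, Pi.single ((![0, 0, 0, 1, 1, 2] : Fin 6 → Fin 4) S) (1 : K),
        Pi.single ((![1, 2, 3, 2, 3, 3] : Fin 6 → Fin 4) S) 1, Pi.single 2 1]).permanent =
      (![a 3, 0, a 1, 0, a 0, 0] : Fin 6 → K) S ∧
    (Matrix.of ![a, Pi.single ((![0, 0, 0, 1, 1, 2] : Fin 6 → Fin 4) S) (1 : K),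
        Pi.single ((![1, 2, 3, 2, 3, 3] : Fin 6 → Fin 4) S) 1, Pi.single 3 1]).permanent =
      (![a 2, a 1, 0, a 0, 0, 0] : Fin 6 → K) S := by
  fin_cases S <;> refine ⟨?_, ?_, ?_, ?_⟩ <;> simp [permanent_of_rows]

/-! ### The rank lemma for the gram identity on `H × K⁴` -/

omit [Fintype ι] in
/-- **`Λ a = 0` on a `≥ 3`-dimensional `H` forces `Λ = 0`** for the symmetric zero-diagonal
`Λ = ((κ_{{l,m}ᶜ}))_{l,m}` (six entries `κ_S`, `S = 01,02,03,12,13,23`). [folklore] -/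
theorem kappa_eq_zero (H : Submodule K (Fin 4 → K)) (hH : 3 ≤ finrank K H) (κ : Fin 6 → K)
    (h0 : ∀ a ∈ H, κ 3 * a 3 + κ 4 * a 2 + κ 5 * a 1 = 0)
    (h1 : ∀ a ∈ H, κ 1 * a 3 + κ 2 * a 2 + κ 5 * a 0 = 0)
    (h2 : ∀ a ∈ H, κ 0 * a 3 + κ 2 * a 1 + κ 4 * a 0 = 0)
    (h3 : ∀ a ∈ H, κ 0 * a 2 + κ 1 * a 1 + κ 3 * a 0 = 0) : κ = 0 := by
  let R0 : (Fin 4 → K) →ₗ[K] K :=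
    κ 3 • LinearMap.proj 3 + κ 4 • LinearMap.proj 2 + κ 5 • LinearMap.proj 1
  let R1 : (Fin 4 → K) →ₗ[K] K :=
    κ 1 • LinearMap.proj 3 + κ 2 • LinearMap.proj 2 + κ 5 • LinearMap.proj 0
  let R2 : (Fin 4 → K) →ₗ[K] K :=
    κ 0 • LinearMap.proj 3 + κ 2 • LinearMap.proj 1 + κ 4 • LinearMap.proj 0
  let R3 : (Fin 4 → K) →ₗ[K] K :=
    κ 0 • LinearMap.proj 2 + κ 1 • LinearMap.proj 1 + κ 3 • LinearMap.proj 0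
  have e0 : ∀ a, R0 a = κ 3 * a 3 + κ 4 * a 2 + κ 5 * a 1 := fun a => by simp [R0]
  have e1 : ∀ a, R1 a = κ 1 * a 3 + κ 2 * a 2 + κ 5 * a 0 := fun a => by simp [R1]
  have e2 : ∀ a, R2 a = κ 0 * a 3 + κ 2 * a 1 + κ 4 * a 0 := fun a => by simp [R2]
  have e3 : ∀ a, R3 a = κ 0 * a 2 + κ 1 * a 1 + κ 3 * a 0 := fun a => by simp [R3]
  have hR0 : ∀ a ∈ H, R0 a = 0 := fun a ha => by rw [e0]; exact h0 a ha
  have hR1 : ∀ a ∈ H, R1 a = 0 := fun a ha => by rw [e1]; exact h1 a ha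
  have hR2 : ∀ a ∈ H, R2 a = 0 := fun a ha => by rw [e2]; exact h2 a ha
  have hR3 : ∀ a ∈ H, R3 a = 0 := fun a ha => by rw [e3]; exact h3 a ha
  have key : ∀ (f g : (Fin 4 → K) →ₗ[K] K) (x y : Fin 4 → K), (∀ a ∈ H, f a = 0) →
      (∀ a ∈ H, g a = 0) → f x ≠ 0 → g x = 0 → f y = 0 → g y ≠ 0 → False :=
    fun f g x y hf hg hfx hgx hfy hgy => by
      have := finrank_le_two_of_two_functionals H f g hf hg x y hfx hgx hfy hgy
      omega
  funext S
  rw [Pi.zero_apply]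
  by_contra hS
  fin_cases S
  · exact key R2 R3 (Pi.single 3 1) (Pi.single 2 1) hR2 hR3 (by simpa [e2] using hS)
      (by simp [e3]) (by simp [e2]) (by simpa [e3] using hS)
  · exact key R1 R3 (Pi.single 3 1) (Pi.single 1 1) hR1 hR3 (by simpa [e1] using hS)
      (by simp [e3]) (by simp [e1]) (by simpa [e3] using hS)
  · exact key R1 R2 (Pi.single 2 1) (Pi.single 1 1) hR1 hR2 (by simpa [e1] using hS)
      (by simp [e2]) (by simp [e1]) (by simpa [e2] using hS)
  · exact key R0 R3 (Pi.single 3 1) (Pi.single 0 1) hR0 hR3 (by simpa [e0] using hS)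
      (by simp [e3]) (by simp [e0]) (by simpa [e3] using hS)
  · exact key R0 R2 (Pi.single 2 1) (Pi.single 0 1) hR0 hR2 (by simpa [e0] using hS)
      (by simp [e2]) (by simp [e0]) (by simpa [e2] using hS)
  · exact key R0 R1 (Pi.single 1 1) (Pi.single 0 1) hR0 hR1 (by simpa [e0] using hS)
      (by simp [e1]) (by simp [e0]) (by simpa [e1] using hS)

/-! ### Purity: a doubly pure column is impossible -/

/-- **No doubly pure column.**  With `hJ` on `U`, `dim H_a, dim H_b ≥ 3`: if
`t_r((a,0),(e₀,0)) = 0 = t_r((a,0),(0,e₀))` for all `(a,0) ∈ U`, and for every `y ≠ 0` either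
`t_r((a,0),(e_y,0)) = 0` for all `(a,0) ∈ U` or `t_r((a,0),(0,e_y)) = 0` for all `(a,0) ∈ U`, then
`False`: by `cross_U`, `per (a; b; e₀; e_y) = 0` on `H_a × H_b` for `y = 1, 2, 3`, i.e. the three
forms `a₂b₃ + a₃b₂`, `a₁b₃ + a₃b₁`, `a₁b₂ + a₂b₁` vanish there, and two of them already cut `H_b`
down to dimension `≤ 2` once `a ∈ H_a` has `a₁ ≠ 0` or `a₂ ≠ 0`. [folklore] -/
theorem false_of_doubly_pure₀ (c : ι → K)
    (t : ι → (((Fin 4 → K) × (Fin 4 → K)) →ₗ[K] ((Fin 4 → K) × (Fin 4 → K)) →ₗ[K] K))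
    (U : Submodule K ((Fin 4 → K) × (Fin 4 → K)))
    (hJ : ∀ u ∈ U, ∀ y₂ y₃ : Fin 4 → K,
      ∑ r, c r * (t r u (y₂, y₃)) ^ 2 = (Matrix.of ![u.1, u.2, y₂, y₃]).permanent)
    (hUa : 3 ≤ finrank K (U.comap (LinearMap.inl K (Fin 4 → K) (Fin 4 → K))))
    (hUb : 3 ≤ finrank K (U.comap (LinearMap.inr K (Fin 4 → K) (Fin 4 → K))))
    (hτ : ∀ a : Fin 4 → K, ((a, (0 : Fin 4 → K)) : (Fin 4 → K) × (Fin 4 → K)) ∈ U →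
      ∀ r, t r (a, 0) (Pi.single 0 1, 0) = 0)
    (hσ : ∀ a : Fin 4 → K, ((a, (0 : Fin 4 → K)) : (Fin 4 → K) × (Fin 4 → K)) ∈ U →
      ∀ r, t r (a, 0) (0, Pi.single 0 1) = 0)
    (hy : ∀ y : Fin 4, y ≠ 0 →
      (∀ a : Fin 4 → K, ((a, (0 : Fin 4 → K)) : (Fin 4 → K) × (Fin 4 → K)) ∈ U →
        ∀ r, t r (a, 0) (Pi.single y 1, 0) = 0) ∨
      (∀ a : Fin 4 → K, ((a, (0 : Fin 4 → K)) : (Fin 4 → K) × (Fin 4 → K)) ∈ U →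
        ∀ r, t r (a, 0) (0, Pi.single y 1) = 0)) : False := by
  set Ha := U.comap (LinearMap.inl K (Fin 4 → K) (Fin 4 → K)) with hHa
  set Hb := U.comap (LinearMap.inr K (Fin 4 → K) (Fin 4 → K)) with hHb
  have hmemA : ∀ a, a ∈ Ha ↔ ((a, (0 : Fin 4 → K)) : (Fin 4 → K) × (Fin 4 → K)) ∈ U :=
    fun a => Submodule.mem_comap
  have hmemB : ∀ b, b ∈ Hb ↔ (((0 : Fin 4 → K), b) : (Fin 4 → K) × (Fin 4 → K)) ∈ U :=
    fun b => Submodule.mem_comap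
  -- `per (a; b; e₀; e_y) = 0` on `H_a × H_b` for `y ≠ 0`
  have hper : ∀ a ∈ Ha, ∀ b ∈ Hb, ∀ y : Fin 4, y ≠ 0 →
      (Matrix.of ![a, b, Pi.single 0 1, Pi.single y 1]).permanent = 0 := by
    intro a ha b hb y hy0
    rw [hmemA] at ha; rw [hmemB] at hb
    rcases hy y hy0 with h | h
    · have := cross_U c t U hJ a b ha hb (Pi.single y 1) (Pi.single 0 1)
      rw [show ∑ r, c r * (t r (a, 0) (Pi.single y 1, 0) * t r (0, b) (0, Pi.single 0 1) +
          t r (0, b) (Pi.single y 1, 0) * t r (a, 0) (0, Pi.single 0 1)) = 0 from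
        Finset.sum_eq_zero fun r _ => by rw [h a ha r, hσ a ha r]; ring, mul_zero] at this
      rw [← per_swap_row₂₃]; exact this.symm
    · have := cross_U c t U hJ a b ha hb (Pi.single 0 1) (Pi.single y 1)
      rw [show ∑ r, c r * (t r (a, 0) (Pi.single 0 1, 0) * t r (0, b) (0, Pi.single y 1) +
          t r (0, b) (Pi.single 0 1, 0) * t r (a, 0) (0, Pi.single y 1)) = 0 from
        Finset.sum_eq_zero fun r _ => by rw [hτ a ha r, h a ha r]; ring, mul_zero] at this
      exact this.symm
  have hp1 : ∀ a ∈ Ha, ∀ b ∈ Hb, a 2 * b 3 + a 3 * b 2 = 0 := fun a ha b hb => by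
    have := hper a ha b hb 1 (by decide); rw [permanent_of_rows] at this; simpa using this
  have hp2 : ∀ a ∈ Ha, ∀ b ∈ Hb, a 1 * b 3 + a 3 * b 1 = 0 := fun a ha b hb => by
    have := hper a ha b hb 2 (by decide); rw [permanent_of_rows] at this; simpa using this
  have hp3 : ∀ a ∈ Ha, ∀ b ∈ Hb, a 1 * b 2 + a 2 * b 1 = 0 := fun a ha b hb => by
    have := hper a ha b hb 3 (by decide); rw [permanent_of_rows] at this; simpa using this
  -- some `a ∈ H_a` has `a 1 ≠ 0` or `a 2 ≠ 0`
  obtain ⟨a, ha, h12⟩ : ∃ a ∈ Ha, a 1 ≠ 0 ∨ a 2 ≠ 0 := by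
    by_contra hne
    push Not at hne
    have := finrank_le_two_of_two_functionals Ha (LinearMap.proj 1) (LinearMap.proj 2)
      (fun a ha => (hne a ha).1) (fun a ha => (hne a ha).2) (Pi.single 1 1) (Pi.single 2 1)
      (by simp) (by simp) (by simp) (by simp)
    omega
  rcases h12 with h1 | h2
  · -- the functionals `b ↦ a₁b₂ + a₂b₁`, `b ↦ a₁b₃ + a₃b₁` vanish on `H_b`
    have := finrank_le_two_of_two_functionals Hb
      (a 1 • LinearMap.proj 2 + a 2 • LinearMap.proj 1) (a 1 • LinearMap.proj 3 + a 3 • LinearMap.proj 1)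
      (fun b hb => by simpa using hp3 a ha b hb) (fun b hb => by simpa using hp2 a ha b hb)
      (Pi.single 2 1) (Pi.single 3 1) (by simpa using h1) (by simp) (by simp) (by simpa using h1)
    omega
  · have := finrank_le_two_of_two_functionals Hb
      (a 1 • LinearMap.proj 2 + a 2 • LinearMap.proj 1) (a 2 • LinearMap.proj 3 + a 3 • LinearMap.proj 2)
      (fun b hb => by simpa using hp3 a ha b hb) (fun b hb => by simpa using hp1 a ha b hb)
      (Pi.single 1 1) (Pi.single 3 1) (by simpa using h2) (by simp) (by simp) (by simpa using h2)
    omega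


end Summit.ValiantsHypothesis.ValiantsHypothesis.Theorems.SymPencilPerFourInnerRankHypPurity

end
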